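import Summits.MatrixMultiplication.MatrixMultiplication.Theses.AsymptoticRankCW
import Literature.Computability.AlgebraicComplexity.FlatteningRank
import Literature.Barriers.MatrixMultiplication.IrreversibilityBarrierThm19

/-!
# MatrixMultiplication / AsymptoticRankCW — the lower frame `3^N ≤ R(T_cw,2^{⊗N})`

Route `MatrixMultiplication/AsymptoticRankCW`, support item `stmt-MatrixMultiplication-0592`
(`BLowerFrame`): for every `N`, `3 ^ N ≤ R(T_cw,2^{⊗N})`, the Kronecker power of the small
Coppersmith–Winograd tensor `T_cw,2 ∈ ℂ³⊗ℂ³⊗ℂ³` written inline on `Fin N → Fin 3`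
(definitionally `kroneckerPow (cwTensor ℂ 2) N`).

Proof (Bürgisser–Clausen–Shokrollahi 1997, Ex. 15.24; Conner–Gesmundo–Landsberg–Ventura 2022,
§1.2 — the elementary half of the lower bound): the first flattening of `T_cw,2` has rank `3`
(`Literature.Barriers.MatrixMultiplication.flatteningRank_cwTensor`), flattening rank is
multiplicative under Kronecker powers (`flatteningRank_kroneckerPow`) and bounded by the tensor
rank (`flatteningRank_le_tensorRank`), so `3^N = ζ⁽¹⁾(T_cw,2)^N = ζ⁽¹⁾(T_cw,2^{⊗N}) ≤ R(T_cw,2^{⊗N})`.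
-/

noncomputable section

-- `Summit.MatrixMultiplication.MatrixMultiplication.Theorems` is the layout-mandated namespace (Sub = Summit).
set_option linter.dupNamespace false

namespace Summit.MatrixMultiplication.MatrixMultiplication.Theorems

open Literature.Computability.AlgebraicComplexity

/-- **`3 ^ N ≤ R(T_cw,2^{⊗N})`** for the tree's `kroneckerPow (cwTensor ℂ 2) N`: flattening rank
`3` of `T_cw,2`, multiplicativity of `ζ⁽¹⁾` under Kronecker powers, and `ζ⁽¹⁾ ≤ R`
(BCS 1997, Ex. 15.24; CGLV 2022, §1.2). [cite: BurgisserClausenShokrollahi1997, Ex. 15.24] -/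
theorem pow_three_le_tensorRank_kroneckerPow_cwTensor_two (N : ℕ) :
    3 ^ N ≤ tensorRank (kroneckerPow (cwTensor ℂ 2) N) := by
  have h := flatteningRank_le_tensorRank (kroneckerPow (cwTensor ℂ 2) N)
  rwa [flatteningRank_kroneckerPow,
    Literature.Barriers.MatrixMultiplication.flatteningRank_cwTensor (K := ℂ) (q := 2) (by norm_num)]
    at h

/-- Settles `stmt-MatrixMultiplication-0592` (`BLowerFrame`, exact route decl): the lower frame
`3 ^ N ≤ R(T_cw,2^{⊗N})` for every `N`, the inline Kronecker power being definitionally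
`kroneckerPow (cwTensor ℂ 2) N`. [cite: BurgisserClausenShokrollahi1997, Ex. 15.24] -/
theorem bLowerFrame_proof :
    Summit.MatrixMultiplication.MatrixMultiplication.Theses.AsymptoticRankCW.BLowerFrame := by
  unfold Summit.MatrixMultiplication.MatrixMultiplication.Theses.AsymptoticRankCW.BLowerFrame
  intro N
  exact pow_three_le_tensorRank_kroneckerPow_cwTensor_two N

end Summit.MatrixMultiplication.MatrixMultiplication.Theorems

end
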